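import Literature.Probability.Distributions.PseudoGaussianSamplerEstimates
import Literature.Computability.Cryptography.StatisticalDistanceProofs
import Mathlib.Probability.Moments.Basic
import Mathlib.MeasureTheory.Function.Floor
import HarnessLib

/-!
# The pseudo-Gaussian sampler is statistically close to the rounded Gaussian

Topic `Probability/Distributions`, sequel of `PseudoGaussianSampler.lean` (the coin-driven sampler with
parameters `P : PGParams`, exact law `ℓ' = P.law` on `(-T, T)`), `PseudoGaussianSamplerEstimates.lean`
(**`gaussBox_le_mul_law`**: the one-sided pointwise domination `ℓ_b(j) ≤ F · ℓ'(j)` on `|j| < T`,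
`F = e^{hR + 2qR² + q}(1 + h)/(1 - p₀^J)`) and `RoundedGaussian.lean` (`ℓ_b = gaussBox b`, the law of
`round(2ᵇ g)`, `g ∼ 𝒩(0, ½)`). Aaronson–Arkhipov's hiding argument only transports UPPER bounds on
failure probabilities and is served by the one-sided domination; a reduction whose ANALYSIS is
written for the exact rounded Gaussian — the perturbation `w` of the first component of Peikert's
`GapSVP → LWE` reduction (`Cryptography/PeikertPerturbation.lean`, law
`GaussianShiftHiding.roundedGaussian`, pqc.S20) — needs the two laws to be close in STATISTICAL
DISTANCE, so that every event (the solver naming the perturbation; the norm tail) changes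
probability by at most `Δ`. One-sided domination of probability vectors gives exactly that:
`Δ(ℓ', ℓ_b) = ∑ⱼ (ℓ_b(j) - ℓ'(j))⁺ ≤ (F - 1) + ℓ_b(|j| ≥ T)`. This file proves it, with an explicit
Gaussian tail:

* `gaussianReal_half_real_Ici_le`, `gaussianReal_half_real_Iic_le` — Chernoff tails of `𝒩(0, ½)`:
  `Pr[x ≥ ε] ≤ e^{-ε²}`, `Pr[x ≤ -ε] ≤ e^{-ε²}` (`ε ≥ 0`; Mathlib's `measure_ge_le_exp_mul_mgf` with the
  Gaussian moment generating function at `t = 2ε`).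
* `gaussBoxPMF b : PMF ℤ` — `ℓ_b` as a probability mass function (`gaussBoxPMF_apply`,
  `toReal_gaussBoxPMF_apply`); `gaussBoxPMF_tail_le` — **`ℓ_b{|j| ≥ T} ≤ 2e^{-((T-½)/2ᵇ)²}`**
  (`round(2ᵇx) ≥ T ⇒ x ≥ (T-½)/2ᵇ`).
* `PGParams.lawPMF : PMF ℤ` — `ℓ'` as a probability mass function (`PMF.ofFinset` on `(-T, T)`,
  `lawPMF_apply`, `toReal_lawPMF_apply`).
* **`PGParams.tvDist_lawPMF_gaussBoxPMF_le`** — for `k ≥ 1` and `p₀^J < 1`: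
  `Δ(ℓ', ℓ_b) ≤ (e^{hR + 2qR² + q}(1 + h)/(1 - p₀^J) - 1) + 2e^{-(R - h/2)²}`
  (`(T - ½)h = R - h/2`); every term tends to `0` for `hR, qR², q, h, p₀^J → 0`, `R → ∞`
  (`pNone_pow_le`: `p₀^J ≤ e^{-Je⁻²/R}`).

All proved; two definitions with bodies (`gaussBoxPMF`, `PGParams.lawPMF`), no named fact.

## References

* S. Aaronson, A. Arkhipov, *The computational complexity of linear optics*, Theory of Computing 9
  (2013) 143–252, §5.2 (the sampler's role) [AaronsonArkhipov2013].
* O. Goldreich, *Foundations of Cryptography I*, CUP 2001, §3.2.1 (statistical distance; `Δ` bounds the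
  change of every event) [Goldreich2001].
* C. Peikert, *Public-key cryptosystems from the worst-case shortest vector problem*, STOC 2009,
  proof of Thm. 3.1 (the consumer: the perturbation law must be sampled by the reduction) [Peikert2009].
-/

noncomputable section

namespace Literature.Probability.Distributions

open MeasureTheory ProbabilityTheory Real Finset
open scoped NNReal ENNReal

/-! ### Chernoff tails of `𝒩(0, ½)` -/

/-- **Upper tail of `𝒩(0, ½)`**: `Pr[x ≥ ε] ≤ e^{-ε²}` for `ε ≥ 0` (Chernoff:
`e^{-tε} E[e^{tx}] = e^{-tε + t²/4}` at `t = 2ε`). [folklore] -/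
theorem gaussianReal_half_real_Ici_le {ε : ℝ} (hε : 0 ≤ ε) :
    (gaussianReal 0 (1 / 2 : ℝ≥0)).real {x : ℝ | ε ≤ x} ≤ exp (-ε ^ 2) := by
  have h := measure_ge_le_exp_mul_mgf (μ := gaussianReal 0 (1 / 2 : ℝ≥0)) (X := id) ε
    (t := 2 * ε) (by positivity) (integrable_exp_mul_gaussianReal (μ := 0) (v := (1 / 2 : ℝ≥0)) (2 * ε))
  have hmgf : mgf id (gaussianReal 0 (1 / 2 : ℝ≥0)) (2 * ε) = exp (ε ^ 2) := by
    rw [congrFun mgf_id_gaussianReal (2 * ε)]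
    congr 1
    push_cast
    ring
  rw [hmgf, ← Real.exp_add] at h
  have heq : -(2 * ε) * ε + ε ^ 2 = -ε ^ 2 := by ring
  rw [heq] at h
  exact h

/-- **Lower tail of `𝒩(0, ½)`**: `Pr[x ≤ -ε] ≤ e^{-ε²}` for `ε ≥ 0`. [folklore] -/
theorem gaussianReal_half_real_Iic_le {ε : ℝ} (hε : 0 ≤ ε) :
    (gaussianReal 0 (1 / 2 : ℝ≥0)).real {x : ℝ | x ≤ -ε} ≤ exp (-ε ^ 2) := by
  have h := measure_le_le_exp_mul_mgf (μ := gaussianReal 0 (1 / 2 : ℝ≥0)) (X := id) (-ε)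
    (t := -(2 * ε)) (by linarith) (integrable_exp_mul_gaussianReal (μ := 0) (v := (1 / 2 : ℝ≥0)) _)
  have hmgf : mgf id (gaussianReal 0 (1 / 2 : ℝ≥0)) (-(2 * ε)) = exp (ε ^ 2) := by
    rw [congrFun mgf_id_gaussianReal (-(2 * ε))]
    congr 1
    push_cast
    ring
  rw [hmgf, ← Real.exp_add] at h
  have heq : - -(2 * ε) * -ε + ε ^ 2 = -ε ^ 2 := by ring
  rw [heq] at h
  exact h

/-! ### The rounded Gaussian `ℓ_b` as a `PMF` on `ℤ` -/

/-- `x ↦ round(2ᵇ x)` is measurable. [folklore] -/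
theorem measurable_round_two_pow_mul (b : ℕ) : Measurable fun x : ℝ => round ((2 : ℝ) ^ b * x) := by
  have h : (fun x : ℝ => round ((2 : ℝ) ^ b * x)) = fun x => ⌊(2 : ℝ) ^ b * x + 1 / 2⌋ := by
    funext x; exact round_eq _
  rw [h]
  exact Int.measurable_floor.comp ((measurable_const.mul measurable_id).add_const _)

/-- The law of `round(2ᵇ g)`, `g ∼ 𝒩(0, ½)`, as a measure on `ℤ`. [folklore] -/
def gaussBoxMeasure (b : ℕ) : Measure ℤ :=
  (gaussianReal 0 (1 / 2 : ℝ≥0)).map fun x : ℝ => round ((2 : ℝ) ^ b * x)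

/-- `gaussBoxMeasure` is a probability measure. [folklore] -/
instance isProbabilityMeasure_gaussBoxMeasure (b : ℕ) : IsProbabilityMeasure (gaussBoxMeasure b) :=
  Measure.isProbabilityMeasure_map (measurable_round_two_pow_mul b).aemeasurable

/-- **The rounded Gaussian `ℓ_b` as a probability mass function on `ℤ`**: the law of `round(2ᵇ g)`,
`g ∼ 𝒩(0, ½)` (its values are the `gaussBox b j` of `RoundedGaussian.lean`). [folklore] -/
def gaussBoxPMF (b : ℕ) : PMF ℤ := (gaussBoxMeasure b).toPMF

/-- Events under `gaussBoxPMF` are Gaussian probabilities of preimages. [folklore] -/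
theorem gaussBoxPMF_toOuterMeasure_apply (b : ℕ) (S : Set ℤ) :
    (gaussBoxPMF b).toOuterMeasure S =
      gaussianReal 0 (1 / 2 : ℝ≥0) ((fun x : ℝ => round ((2 : ℝ) ^ b * x)) ⁻¹' S) := by
  rw [← PMF.toMeasure_apply_eq_toOuterMeasure _ S, gaussBoxPMF, Measure.toPMF_toMeasure, gaussBoxMeasure,
    Measure.map_apply (measurable_round_two_pow_mul b) (MeasurableSet.of_discrete (s := S))]

/-- **`gaussBoxPMF b j = ℓ_b(j)`.** [folklore] -/
theorem gaussBoxPMF_apply (b : ℕ) (j : ℤ) : gaussBoxPMF b j = ENNReal.ofReal (gaussBox b j) := by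
  rw [← PMF.toOuterMeasure_apply_singleton, gaussBoxPMF_toOuterMeasure_apply, gaussBox, measureReal_def,
    ENNReal.ofReal_toReal (measure_ne_top _ _)]
  rfl

/-- `(gaussBoxPMF b j).toReal = ℓ_b(j)`. [folklore] -/
theorem toReal_gaussBoxPMF_apply (b : ℕ) (j : ℤ) : (gaussBoxPMF b j).toReal = gaussBox b j := by
  rw [gaussBoxPMF_apply, ENNReal.toReal_ofReal (gaussBox_nonneg b j)]

/-- **The tail of the rounded Gaussian**: `ℓ_b{|j| ≥ T} ≤ 2e^{-((T - ½)/2ᵇ)²}` for `T ≥ 1`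
(`round(2ᵇx) ≥ T ⇒ x ≥ (T - ½)/2ᵇ`, `round(2ᵇx) ≤ -T ⇒ x ≤ -(T - ½)/2ᵇ`, and the two Chernoff tails).
[folklore] -/
theorem gaussBoxPMF_tail_le (b : ℕ) {T : ℕ} (hT : 1 ≤ T) :
    ((gaussBoxPMF b).toOuterMeasure {j : ℤ | T ≤ j.natAbs}).toReal ≤
      2 * exp (-(((T : ℝ) - 1 / 2) / (2 : ℝ) ^ b) ^ 2) := by
  set ε : ℝ := ((T : ℝ) - 1 / 2) / (2 : ℝ) ^ b with hεdef
  have hN : (0 : ℝ) < (2 : ℝ) ^ b := by positivity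
  have hT' : (1 : ℝ) ≤ T := by exact_mod_cast hT
  have hε : 0 ≤ ε := by rw [hεdef]; exact div_nonneg (by linarith) hN.le
  rw [gaussBoxPMF_toOuterMeasure_apply]
  -- the preimage of the tail lies in the union of the two real tails
  have hsub : (fun x : ℝ => round ((2 : ℝ) ^ b * x)) ⁻¹' {j : ℤ | T ≤ j.natAbs} ⊆
      {x : ℝ | ε ≤ x} ∪ {x : ℝ | x ≤ -ε} := by
    intro x hx
    simp only [Set.mem_preimage, Set.mem_setOf_eq] at hx
    set y : ℝ := (2 : ℝ) ^ b * x with hy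
    have hr : round y = ⌊y + 1 / 2⌋ := round_eq y
    have hfl := Int.floor_le (y + 1 / 2)
    have hlt := Int.lt_floor_add_one (y + 1 / 2)
    rw [← hr] at hfl hlt
    rcases le_or_gt 0 (round y) with h0 | h0
    · -- `round y ≥ T`
      left
      have hj : (T : ℤ) ≤ round y := by
        have : ((round y).natAbs : ℤ) = round y := Int.natAbs_of_nonneg h0
        omega
      have hjR : (T : ℝ) ≤ (round y : ℝ) := by exact_mod_cast hj
      show ε ≤ x
      rw [hεdef, div_le_iff₀ hN]
      have : x * (2 : ℝ) ^ b = y := by rw [hy]; ring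
      rw [this]
      linarith
    · -- `round y ≤ -T`
      right
      have hj : round y ≤ -(T : ℤ) := by
        have : ((round y).natAbs : ℤ) = -round y := Int.ofNat_natAbs_of_nonpos h0.le
        omega
      have hjR : (round y : ℝ) ≤ -(T : ℝ) := by exact_mod_cast hj
      show x ≤ -ε
      rw [hεdef, ← neg_div, le_div_iff₀ hN]
      have : x * (2 : ℝ) ^ b = y := by rw [hy]; ring
      rw [this]
      linarith
  calc (gaussianReal 0 (1 / 2 : ℝ≥0) ((fun x : ℝ => round ((2 : ℝ) ^ b * x)) ⁻¹' {j : ℤ | T ≤ j.natAbs})).toReal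
      ≤ (gaussianReal 0 (1 / 2 : ℝ≥0) ({x : ℝ | ε ≤ x} ∪ {x : ℝ | x ≤ -ε})).toReal :=
        ENNReal.toReal_mono (measure_ne_top _ _) (measure_mono hsub)
    _ ≤ (gaussianReal 0 (1 / 2 : ℝ≥0) {x : ℝ | ε ≤ x}).toReal +
          (gaussianReal 0 (1 / 2 : ℝ≥0) {x : ℝ | x ≤ -ε}).toReal := by
        rw [← ENNReal.toReal_add (measure_ne_top _ _) (measure_ne_top _ _)]
        exact ENNReal.toReal_mono (ENNReal.add_ne_top.2 ⟨measure_ne_top _ _, measure_ne_top _ _⟩)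
          (measure_union_le _ _)
    _ ≤ exp (-ε ^ 2) + exp (-ε ^ 2) :=
        add_le_add (gaussianReal_half_real_Ici_le hε) (gaussianReal_half_real_Iic_le hε)
    _ = 2 * exp (-ε ^ 2) := by ring

/-! ### The sampler's law `ℓ'` as a `PMF` on `ℤ` -/

namespace PGParams

variable (P : PGParams)

/-- **The sampler's law `ℓ'` as a probability mass function on `ℤ`** (supported on `(-T, T)`, where it
sums to `1`: `sum_law`, `law_eq_zero`). [folklore] -/
def lawPMF : PMF ℤ :=
  PMF.ofFinset (fun j => ENNReal.ofReal (P.law j)) (Ioo (-(P.T : ℤ)) P.T)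
    (by rw [← ENNReal.ofReal_sum_of_nonneg (fun j _ => P.law_nonneg j), P.sum_law, ENNReal.ofReal_one])
    (fun j hj => by
      rw [ENNReal.ofReal_eq_zero]
      refine le_of_eq (P.law_eq_zero ?_)
      simp only [mem_Ioo, not_and_or, not_lt] at hj
      rcases hj with hj | hj <;> omega)

/-- `lawPMF j = ℓ'(j)`. [folklore] -/
theorem lawPMF_apply (j : ℤ) : P.lawPMF j = ENNReal.ofReal (P.law j) := rfl

/-- `(lawPMF j).toReal = ℓ'(j)`. [folklore] -/
theorem toReal_lawPMF_apply (j : ℤ) : (P.lawPMF j).toReal = P.law j := by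
  rw [lawPMF_apply, ENNReal.toReal_ofReal (P.law_nonneg j)]

/-- The law vanishes outside `(-T, T)`: `lawPMF j = 0` for `|j| ≥ T`. [folklore] -/
theorem lawPMF_apply_eq_zero {j : ℤ} (hj : P.T ≤ j.natAbs) : P.lawPMF j = 0 := by
  rw [lawPMF_apply, P.law_eq_zero hj, ENNReal.ofReal_zero]

/-- The support of the law lies in `(-T, T)`: `|j| < T` on the support. [folklore] -/
theorem natAbs_lt_of_mem_support_lawPMF {j : ℤ} (hj : j ∈ P.lawPMF.support) : j.natAbs < P.T := by
  by_contra h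
  exact (PMF.mem_support_iff _ _).1 hj (P.lawPMF_apply_eq_zero (not_lt.1 h))

/-! ### The statistical distance -/

/-- **One-sided domination bounds the statistical distance.** For probability vectors `μ`, `ν` on `ℤ`
with `ν` supported on a set `S`, `μ ≤ F·ν` on `S` (`F ≥ 1`) implies
`½ ∑ |ν - μ| = ∑ (μ - ν)⁺ ≤ (F - 1) + μ(Sᶜ)`. Here, for the sampler: `Δ(ℓ', ℓ_b) ≤ (F - 1) + ℓ_b{|j| ≥ T}`
with the factor `F = e^{hR + 2qR² + q}(1 + h)/(1 - p₀^J)` of `gaussBox_le_mul_law` (`k ≥ 1`, `p₀^J < 1`),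
and the tail `ℓ_b{|j| ≥ T} ≤ 2e^{-(R - h/2)²}` (`(T - ½)h = R - h/2`). [folklore] -/
theorem tvDist_lawPMF_gaussBoxPMF_le (hk : 1 ≤ P.k) (hJ : P.pNone ^ P.J < 1) :
    P.lawPMF.tvDist (gaussBoxPMF P.b) ≤
      (exp (P.h * P.R + 2 * P.q * P.R ^ 2 + P.q) * (1 + P.h) / (1 - P.pNone ^ P.J) - 1) +
        2 * exp (-(P.R - P.h / 2) ^ 2) := by
  set F : ℝ := exp (P.h * P.R + 2 * P.q * P.R ^ 2 + P.q) * (1 + P.h) / (1 - P.pNone ^ P.J) with hFdef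
  set μ : ℤ → ℝ := fun j => gaussBox P.b j with hμ
  set ν : ℤ → ℝ := fun j => P.law j with hν
  have hh := P.h_pos
  -- `F ≥ 1`
  have hF1 : 1 ≤ F := by
    rw [hFdef, le_div_iff₀ (by linarith), one_mul]
    have h1 : 1 ≤ exp (P.h * P.R + 2 * P.q * P.R ^ 2 + P.q) := Real.one_le_exp (by
      have := P.q_pos; have : 0 ≤ P.R := by unfold PGParams.R; positivity
      positivity)
    have h2 : 1 - P.pNone ^ P.J ≤ 1 := by linarith [pow_nonneg P.pNone_nonneg P.J]
    nlinarith
  -- the dominating function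
  set g : ℤ → ℝ := fun j => if j.natAbs < P.T then (F - 1) * ν j else μ j with hg
  have hdom : ∀ j, μ j - ν j ≤ g j := by
    intro j
    by_cases hj : j.natAbs < P.T
    · simp only [hg, if_pos hj, hμ, hν]
      have := P.gaussBox_le_mul_law hk hJ hj
      linarith
    · simp only [hg, if_neg hj, hμ, hν]
      rw [P.law_eq_zero (not_lt.1 hj), sub_zero]
  have hpos : ∀ j, max (μ j - ν j) 0 ≤ g j := by
    intro j
    refine max_le (hdom j) ?_
    by_cases hj : j.natAbs < P.T
    · simp only [hg, if_pos hj]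
      exact mul_nonneg (by linarith) (P.law_nonneg j)
    · simp only [hg, if_neg hj]
      exact gaussBox_nonneg _ _
  -- summability
  have hμsum : Summable μ := by
    have := PMF.summable_coe_toReal (gaussBoxPMF P.b)
    simpa only [toReal_gaussBoxPMF_apply] using this
  have hμ1 : ∑' j, μ j = 1 := by
    have := PMF.tsum_coe_toReal (gaussBoxPMF P.b)
    simpa only [toReal_gaussBoxPMF_apply] using this
  have hνsupp : ∀ j ∉ Ioo (-(P.T : ℤ)) P.T, ν j = 0 := by
    intro j hj
    refine P.law_eq_zero ?_
    simp only [mem_Ioo, not_and_or, not_lt] at hj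
    rcases hj with hj | hj <;> omega
  have hνsum : Summable ν := summable_of_ne_finset_zero hνsupp
  have hν1 : ∑' j, ν j = 1 := by rw [tsum_eq_sum hνsupp]; exact P.sum_law
  have habs : ∀ j, |ν j - μ j| = (ν j - μ j) + 2 * max (μ j - ν j) 0 := by
    intro j
    rcases le_or_gt (μ j) (ν j) with h | h
    · rw [max_eq_right (by linarith), abs_of_nonneg (by linarith)]; ring
    · rw [max_eq_left (by linarith), abs_of_neg (by linarith)]; ring
  have hmaxsum : Summable fun j => max (μ j - ν j) 0 :=
    Summable.of_nonneg_of_le (fun j => le_max_right _ _)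
      (fun j => max_le ((sub_le_self _ (P.law_nonneg j)).trans (le_abs_self _)) (abs_nonneg _))
      hμsum.abs
  -- the tail sum of `g` outside the range, and the range part
  have hgsplit : ∀ j, g j = (if j.natAbs < P.T then (F - 1) * ν j else 0) +
      (if j.natAbs < P.T then 0 else μ j) := by
    intro j; by_cases hj : j.natAbs < P.T <;> simp [hg, hj]
  have hg1sum : Summable fun j : ℤ => if j.natAbs < P.T then (F - 1) * ν j else 0 := by
    refine summable_of_ne_finset_zero (s := Ioo (-(P.T : ℤ)) P.T) fun j hj => ?_
    rw [hνsupp j hj, mul_zero, ite_self]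
  have hg2sum : Summable fun j : ℤ => if j.natAbs < P.T then 0 else μ j :=
    Summable.of_nonneg_of_le (fun j => by split_ifs <;> [exact le_rfl; exact gaussBox_nonneg _ _])
      (fun j => by split_ifs <;> [exact gaussBox_nonneg _ _; exact le_rfl]) hμsum
  have hgsum : Summable g := by
    have := hg1sum.add hg2sum
    exact this.congr fun j => (hgsplit j).symm
  -- (1) the range part: `≤ (F - 1) · 1`
  have h1 : ∑' j : ℤ, (if j.natAbs < P.T then (F - 1) * ν j else 0) ≤ F - 1 := by
    have hle : ∀ j, (if j.natAbs < P.T then (F - 1) * ν j else 0) ≤ (F - 1) * ν j := by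
      intro j; split_ifs
      · exact le_rfl
      · exact mul_nonneg (by linarith) (P.law_nonneg j)
    calc ∑' j : ℤ, (if j.natAbs < P.T then (F - 1) * ν j else 0) ≤ ∑' j, (F - 1) * ν j :=
          hg1sum.tsum_le_tsum hle (hνsum.mul_left _)
      _ = F - 1 := by rw [tsum_mul_left, hν1, mul_one]
  -- (2) the tail part
  have h2 : ∑' j : ℤ, (if j.natAbs < P.T then 0 else μ j) ≤ 2 * exp (-(P.R - P.h / 2) ^ 2) := by
    have htail := gaussBoxPMF_tail_le P.b (T := P.T) P.T_pos
    have heq : ((gaussBoxPMF P.b).toOuterMeasure {j : ℤ | P.T ≤ j.natAbs}).toReal =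
        ∑' j : ℤ, (if j.natAbs < P.T then 0 else μ j) := by
      rw [PMF.toOuterMeasure_apply, ENNReal.tsum_toReal_eq (fun j => by
        refine ne_top_of_le_ne_top (PMF.apply_ne_top (gaussBoxPMF P.b) j) ?_
        exact Set.indicator_le_self _ _ j)]
      refine tsum_congr fun j => ?_
      by_cases hj : j.natAbs < P.T
      · rw [Set.indicator_of_notMem (by simpa using hj), if_pos hj, ENNReal.toReal_zero]
      · rw [Set.indicator_of_mem (by simpa using hj), if_neg hj, toReal_gaussBoxPMF_apply]
    rw [← heq]
    refine htail.trans (le_of_eq ?_)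
    congr 2
    have hTh : ((P.T : ℝ) - 1 / 2) / (2 : ℝ) ^ P.b = P.R - P.h / 2 := by
      rw [← T_mul_h, PGParams.h]
      field_simp
    rw [hTh]
  -- assemble: `Δ = ½ ∑ |ν - μ| = ∑ (μ - ν)⁺ ≤ ∑ g`
  have htv : P.lawPMF.tvDist (gaussBoxPMF P.b) = ∑' j, max (μ j - ν j) 0 := by
    unfold PMF.tvDist
    simp only [toReal_lawPMF_apply, toReal_gaussBoxPMF_apply]
    change 2⁻¹ * ∑' j, |ν j - μ j| = _
    simp_rw [habs]
    rw [(hνsum.sub hμsum).tsum_add (hmaxsum.mul_left 2), tsum_mul_left, hνsum.tsum_sub hμsum,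
      hν1, hμ1]
    ring
  rw [htv]
  calc ∑' j, max (μ j - ν j) 0 ≤ ∑' j, g j := hmaxsum.tsum_le_tsum hpos hgsum
    _ = ∑' j : ℤ, ((if j.natAbs < P.T then (F - 1) * ν j else 0) +
          (if j.natAbs < P.T then 0 else μ j)) := tsum_congr hgsplit
    _ = ∑' j : ℤ, (if j.natAbs < P.T then (F - 1) * ν j else 0) +
          ∑' j : ℤ, (if j.natAbs < P.T then 0 else μ j) := hg1sum.tsum_add hg2sum
    _ ≤ (F - 1) + 2 * exp (-(P.R - P.h / 2) ^ 2) := add_le_add h1 h2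

end PGParams

end Literature.Probability.Distributions

end
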